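import Summits.KontsevichZagierPeriods.KontsevichZagierPeriods.Theorems.UnfoldedStokesStokesGenerationFibrewiseRungScalingSwaps
import Summits.KontsevichZagierPeriods.KontsevichZagierPeriods.Theorems.UnfoldedStokesStokesGenerationFibrewiseClosureCongr

/-!
# `StokesGeneration` (stmt-KontsevichZagierPeriods-3586) — line `fibrewise_stokes`, stub `stub_polylogArgHomotopy3`

Registered rung stub G3 (rung 24, the weight-THREE Landen–Kummer relation, wave 5) of the line `fibrewise_stokes`
of the crux `StokesGeneration` (route UnfoldedStokes): the weight-three POLYLOGARITHM-ARGUMENT HOMOTOPY. The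
trilogarithm `Li₃(w)` has the cube integrand `T_w(s,t,u) = w/(1 − w s t u)` on `[0,1]³`; moving the argument along a
`ℚ`-semialgebraic `C¹` path `v ↦ w(v)` with `w(v) < 1` on `[0,1]` trades the difference of the endpoint integrands
`T_{w(1)} − T_{w(0)}` for the one-weight-lower leftover `w′(v)/(1 − w(v) s t)` (the integrand of
`(w′/w)·Li₂(w)`, `dLi₃(w) = Li₂(w) dw/w`) with the silent parameter `v`. Precisely, on the closed cube `[0,1]⁴`
(`s = x 0`, `t = x 1`, `u = x 2`, `v = x 3`) the function
`w′(v)/(1 − w(v) s t) − (w(1)/(1 − w(1) s t u) − w(0)/(1 − w(0) s t u))`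
is fibrewise-Stokes decomposable (`FibStokesDecomposable 4`, `Theorems/UnfoldedStokesDefs.lean`).

Proof. Two fibrewise Stokes elements on the same cube, no kink sets, no transcendence input:
* along `v` (direction `3`) with primitive `G₀ = w(v)/(1 − w(v) s t u)`, fibre derivative
  `D₀ = w′(v)/(1 − w(v) s t u)²` (chain rule, at the points with `v ∈ (0,1)`) and faces
  `G₀|_{v=1} − G₀|_{v=0} = w(1)/(1 − w(1) s t u) − w(0)/(1 − w(0) s t u)`;
* along `u` (direction `2`) with primitive `G₁ = −w′(v) u/(1 − w(v) s t u)`, fibre derivative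
  `D₁ = −w′(v)/(1 − w(v) s t u)²` and faces `G₁|_{u=1} − G₁|_{u=0} = −w′(v)/(1 − w(v) s t)`.
The two integrands `Dⱼ − (faces)` are carried by closed-cube representations (`exists_cubeRep`); the family is
decomposable (`fibStokesDecomposable_of_elements`), and its sum equals the displayed function at every point of the
cube (`D₀ + D₁ = 0`), so `fibStokesDecomposable_congr_off_null` with the empty null set concludes. All denominators
`1 − w(v) p`, `p ∈ [0,1]`, are positive on the closed cube since `w(v) < 1`. This is the weight-two certificate
`stub_polylogArgHomotopy` one weight up.

References: M. Kontsevich, D. Zagier, *Periods* (2001), §1.2 (rule (3), Newton–Leibniz/Stokes);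
D. Zagier, *The dilogarithm function* (2007), §I.2 (functional equations, the Landen/Kummer family).
-/

noncomputable section

-- `Summit.KontsevichZagierPeriods.KontsevichZagierPeriods.…` is the tree's mandated layout (single-conjunct summit).
set_option linter.dupNamespace false

namespace Summit.KontsevichZagierPeriods.KontsevichZagierPeriods.Cruxes.StokesGeneration.FibrewiseStokes

open MeasureTheory Set
open Literature.NumberTheory.Transcendental
open Literature.NumberTheory.Transcendental.KZ
open Literature.ModelTheory.ExponentialFields (IsSemialgebraic)

/-- For `a < 1` and `p ∈ [0,1]` the polylogarithmic denominator `1 − a p` is positive. [folklore] -/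
private theorem argHom3_den_pos {a : ℝ} (ha1 : a < 1) {p : ℝ} (hp : p ∈ Set.Icc (0:ℝ) 1) :
    0 < 1 - a * p := by
  rcases le_or_gt 0 a with ha0 | ha0
  · nlinarith [mul_nonneg ha0 (sub_nonneg.2 hp.2)]
  · nlinarith [mul_nonneg (neg_nonneg.2 ha0.le) hp.1]

/-- **Registered stub `stub_polylogArgHomotopy3` (rung 24, G3): the weight-three polylogarithm-argument homotopy.**
For a `ℚ`-semialgebraic continuous path `w` on `[0,1]` with `w < 1`, `C¹` on `(0,1)` with a `ℚ`-semialgebraic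
continuous derivative `w′`, on `[0,1]⁴` (`s = x 0`, `t = x 1`, `u = x 2`, `v = x 3`) the two elements
`E_v[G = w(v)/(1 − w(v) s t u)]`, `E_u[G = −w′(v) u/(1 − w(v) s t u)]` certify
`w′(v)/(1 − w(v) s t) − (w(1)/(1 − w(1) s t u) − w(0)/(1 − w(0) s t u)) ∈ Dec`
(`∂_v[w(v)/(1 − w(v) s t u)] = w′(v)/(1 − w(v) s t u)² = ∂_u[w′(v) u/(1 − w(v) s t u)]`).
[cite: KontsevichZagier2001, §1.2] -/
theorem stub_polylogArgHomotopy3 (w w' : ℝ → ℝ)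
    (hw : IsSemialgebraicFunOn ℚ (Set.pi Set.univ (fun _ : Fin 1 => Set.Icc (0:ℝ) 1)) (fun z => w (z 0)))
    (hw' : IsSemialgebraicFunOn ℚ (Set.pi Set.univ (fun _ : Fin 1 => Set.Icc (0:ℝ) 1)) (fun z => w' (z 0)))
    (hwc : ContinuousOn w (Set.Icc (0:ℝ) 1)) (hw'c : ContinuousOn w' (Set.Icc (0:ℝ) 1))
    (hwd : ∀ v ∈ Set.Ioo (0:ℝ) 1, HasDerivAt w (w' v) v) (hw1 : ∀ v ∈ Set.Icc (0:ℝ) 1, w v < 1) :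
    FibStokesDecomposable 4 (fun x => w' (x 3) / (1 - w (x 3) * x 0 * x 1) -
      (w 1 / (1 - w 1 * x 0 * x 1 * x 2) - w 0 / (1 - w 0 * x 0 * x 1 * x 2))) := by
  classical
  -- the one-variable data read along the coordinate `v = x 3` of the 4-cube (before naming the cube)
  have hwsa : IsSemialgebraicFunOn ℚ (Set.pi Set.univ (fun _ : Fin 4 => Set.Icc (0:ℝ) 1)) (fun x => w (x 3)) :=
    isSemialgebraicFunOn_read hw 3
  have hw'sa : IsSemialgebraicFunOn ℚ (Set.pi Set.univ (fun _ : Fin 4 => Set.Icc (0:ℝ) 1)) (fun x => w' (x 3)) :=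
    isSemialgebraicFunOn_read hw' 3
  set C : Set (Fin 4 → ℝ) := Set.pi Set.univ (fun _ : Fin 4 => Set.Icc (0:ℝ) 1) with hC
  have hCsa : IsSemialgebraic ℚ C := by rw [hC, ← cube_eq_pi]; exact isSemialgebraic_cube
  have hCc : IsCompact C := isCompact_univ_pi fun _ => isCompact_Icc
  have hmem : ∀ x ∈ C, ∀ i, x i ∈ Set.Icc (0:ℝ) 1 := fun x hx i => (Set.mem_univ_pi.mp hx) i
  have hupd : ∀ x ∈ C, ∀ (i : Fin 4), ∀ s ∈ Set.Icc (0:ℝ) 1, Function.update x i s ∈ C :=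
    fun x hx i s hs => update_mem_cubePi hx i hs
  have h03 : (0 : Fin 4) ≠ 3 := by decide
  have h13 : (1 : Fin 4) ≠ 3 := by decide
  have h23 : (2 : Fin 4) ≠ 3 := by decide
  have h02 : (0 : Fin 4) ≠ 2 := by decide
  have h12 : (1 : Fin 4) ≠ 2 := by decide
  have h32 : (3 : Fin 4) ≠ 2 := by decide
  have h0I : (0:ℝ) ∈ Set.Icc (0:ℝ) 1 := ⟨le_rfl, zero_le_one⟩
  have h1I : (1:ℝ) ∈ Set.Icc (0:ℝ) 1 := ⟨zero_le_one, le_rfl⟩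
  have hmulI : ∀ u ∈ Set.Icc (0:ℝ) 1, ∀ v ∈ Set.Icc (0:ℝ) 1, u * v ∈ Set.Icc (0:ℝ) 1 :=
    fun u hu v hv => ⟨mul_nonneg hu.1 hv.1, by nlinarith [hu.1, hu.2, hv.1, hv.2]⟩
  -- positivity of the denominators on the closed cube
  have hPpos : ∀ x ∈ C, 0 < 1 - w (x 3) * x 0 * x 1 * x 2 := fun x hx => by
    have := argHom3_den_pos (hw1 _ (hmem x hx 3))
      (hmulI _ (hmulI _ (hmem x hx 0) _ (hmem x hx 1)) _ (hmem x hx 2))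
    simpa [mul_assoc] using this
  have hPne : ∀ x ∈ C, 1 - w (x 3) * x 0 * x 1 * x 2 ≠ 0 := fun x hx => (hPpos x hx).ne'
  have hP2ne : ∀ x ∈ C, (1 - w (x 3) * x 0 * x 1 * x 2) ^ 2 ≠ 0 := fun x hx => pow_ne_zero 2 (hPne x hx)
  -- semialgebraic atoms on `C`
  have hx0 : IsSemialgebraicFunOn ℚ C (fun x => x 0) := isSemialgebraicFunOn_apply hCsa 0
  have hx1 : IsSemialgebraicFunOn ℚ C (fun x => x 1) := isSemialgebraicFunOn_apply hCsa 1
  have hx2 : IsSemialgebraicFunOn ℚ C (fun x => x 2) := isSemialgebraicFunOn_apply hCsa 2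
  have hc1 : IsSemialgebraicFunOn ℚ C (fun _ => (1:ℝ)) := isSemialgebraicFunOn_const_of_isAlgebraic hCsa isAlgebraic_one
  have hPsa : IsSemialgebraicFunOn ℚ C (fun x => 1 - w (x 3) * x 0 * x 1 * x 2) :=
    hc1.fun_sub (((hwsa.fun_mul hx0).fun_mul hx1).fun_mul hx2)
  -- continuity on `C`
  have hwcC : ContinuousOn (fun x : Fin 4 → ℝ => w (x 3)) C :=
    hwc.comp (continuous_apply 3).continuousOn fun x hx => hmem x hx 3
  have hw'cC : ContinuousOn (fun x : Fin 4 → ℝ => w' (x 3)) C :=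
    hw'c.comp (continuous_apply 3).continuousOn fun x hx => hmem x hx 3
  have hPc : ContinuousOn (fun x : Fin 4 → ℝ => 1 - w (x 3) * x 0 * x 1 * x 2) C :=
    continuousOn_const.sub (((hwcC.mul (continuous_apply 0).continuousOn).mul
      (continuous_apply 1).continuousOn).mul (continuous_apply 2).continuousOn)
  -- the witnesses
  obtain ⟨G0, hG0⟩ : ∃ G0 : (Fin 4 → ℝ) → ℝ, G0 = fun x => w (x 3) / (1 - w (x 3) * x 0 * x 1 * x 2) := ⟨_, rfl⟩
  obtain ⟨D0, hD0⟩ : ∃ D0 : (Fin 4 → ℝ) → ℝ, D0 = fun x => w' (x 3) / (1 - w (x 3) * x 0 * x 1 * x 2) ^ 2 :=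
    ⟨_, rfl⟩
  obtain ⟨G1, hG1⟩ : ∃ G1 : (Fin 4 → ℝ) → ℝ,
      G1 = fun x => -(w' (x 3) * x 2) / (1 - w (x 3) * x 0 * x 1 * x 2) := ⟨_, rfl⟩
  obtain ⟨D1, hD1⟩ : ∃ D1 : (Fin 4 → ℝ) → ℝ,
      D1 = fun x => -(w' (x 3) / (1 - w (x 3) * x 0 * x 1 * x 2) ^ 2) := ⟨_, rfl⟩
  have hG0sa : IsSemialgebraicFunOn ℚ C G0 := by rw [hG0]; exact hwsa.div hPsa hPne
  have hD0sa : IsSemialgebraicFunOn ℚ C D0 := by rw [hD0]; exact hw'sa.div (hPsa.fun_pow 2) hP2ne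
  have hG1sa : IsSemialgebraicFunOn ℚ C G1 := by rw [hG1]; exact (hw'sa.fun_mul hx2).fun_neg.div hPsa hPne
  have hD1sa : IsSemialgebraicFunOn ℚ C D1 := by rw [hD1]; exact (hw'sa.div (hPsa.fun_pow 2) hP2ne).fun_neg
  have hG0c : ContinuousOn G0 C := by rw [hG0]; exact hwcC.div hPc hPne
  have hD0c : ContinuousOn D0 C := by rw [hD0]; exact hw'cC.div (hPc.pow 2) hP2ne
  have hG1c : ContinuousOn G1 C := by
    rw [hG1]; exact (hw'cC.mul (continuous_apply 2).continuousOn).neg.div hPc hPne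
  have hD1c : ContinuousOn D1 C := by rw [hD1]; exact (hw'cC.div (hPc.pow 2) hP2ne).neg
  -- composition with the (semialgebraic, continuous) face maps `x ↦ x[i ↦ t]`, `t ∈ {0, 1}`
  have hface_sa : ∀ {F : (Fin 4 → ℝ) → ℝ}, IsSemialgebraicFunOn ℚ C F → ∀ (i : Fin 4) (t : ℝ), IsAlgebraic ℚ t →
      t ∈ Set.Icc (0:ℝ) 1 → IsSemialgebraicFunOn ℚ C (fun x => F (Function.update x i t)) :=
    fun hF i t ht htI => IsSemialgebraicFunOn.comp_isSemialgebraicMapOn_holds hF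
      (isSemialgebraicMapOn_update_const i ht) fun x hx => hupd x hx i t htI
  have hface_c : ∀ {F : (Fin 4 → ℝ) → ℝ}, ContinuousOn F C → ∀ (i : Fin 4) (t : ℝ), t ∈ Set.Icc (0:ℝ) 1 →
      ContinuousOn (fun x => F (Function.update x i t)) C :=
    fun hF i t htI => hF.comp (continuous_id.update i continuous_const).continuousOn fun x hx => hupd x hx i t htI
  have hcu : ∀ (x : Fin 4 → ℝ) (i : Fin 4), Continuous fun s : ℝ => Function.update x i s :=
    fun x i => continuous_const.update i continuous_id
  -- the two integrands and their representations on the cube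
  obtain ⟨I0, hI0⟩ : ∃ I0 : (Fin 4 → ℝ) → ℝ, I0 = fun x =>
      D0 x - (G0 (Function.update x 3 1) - G0 (Function.update x 3 0)) := ⟨_, rfl⟩
  obtain ⟨I1, hI1⟩ : ∃ I1 : (Fin 4 → ℝ) → ℝ, I1 = fun x =>
      D1 x - (G1 (Function.update x 2 1) - G1 (Function.update x 2 0)) := ⟨_, rfl⟩
  have hI0sa : IsSemialgebraicFunOn ℚ C I0 := by
    rw [hI0]
    exact hD0sa.fun_sub ((hface_sa hG0sa 3 1 isAlgebraic_one h1I).fun_sub (hface_sa hG0sa 3 0 isAlgebraic_zero h0I))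
  have hI1sa : IsSemialgebraicFunOn ℚ C I1 := by
    rw [hI1]
    exact hD1sa.fun_sub ((hface_sa hG1sa 2 1 isAlgebraic_one h1I).fun_sub (hface_sa hG1sa 2 0 isAlgebraic_zero h0I))
  have hI0c : ContinuousOn I0 C := by
    rw [hI0]; exact hD0c.sub ((hface_c hG0c 3 1 h1I).sub (hface_c hG0c 3 0 h0I))
  have hI1c : ContinuousOn I1 C := by
    rw [hI1]; exact hD1c.sub ((hface_c hG1c 2 1 h1I).sub (hface_c hG1c 2 0 h0I))
  obtain ⟨q0, hq0d, hq0i⟩ := exists_cubeRep 4 I0 hI0sa hI0c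
  obtain ⟨q1, hq1d, hq1i⟩ := exists_cubeRep 4 I1 hI1sa hI1c
  -- bounds
  have hbound : ∀ {F : (Fin 4 → ℝ) → ℝ}, ContinuousOn F C → ∃ B : ℝ, ∀ x ∈ C, |F x| ≤ B := fun hF => by
    obtain ⟨B, hB⟩ := hCc.exists_bound_of_continuousOn hF
    exact ⟨B, fun x hx => by simpa [Real.norm_eq_abs] using hB x hx⟩
  -- assemble the two elements
  have hdec : FibStokesDecomposable 4 (fun x => ∑ j, ((![q0, q1] : Fin 2 → IntegralRep 4) j).integrand x) := by
    refine fibStokesDecomposable_of_elements (M := 4) (J := 2) (![3, 2] : Fin 2 → Fin 4)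
      (![G0, G1] : Fin 2 → (Fin 4 → ℝ) → ℝ) (![D0, D1] : Fin 2 → (Fin 4 → ℝ) → ℝ)
      (![q0, q1] : Fin 2 → IntegralRep 4) ?_ ?_
    · refine Fin.forall_fin_two.mpr ⟨?_, ?_⟩
      · -- element 0, along `v = x 3`
        simp only [Matrix.cons_val_zero]
        refine ⟨hG0sa, hD0sa, hbound hG0c, fun x hx => ?_, fun x hx hx3 => ?_⟩
        · show ContinuousOn (fun s : ℝ => G0 (Function.update x 3 s)) (Set.Icc (0:ℝ) 1)
          exact hG0c.comp (hcu x 3).continuousOn fun s hs => hupd x hx 3 s hs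
        · show HasDerivAt (fun s : ℝ => G0 (Function.update x 3 s)) (D0 x) (x 3)
          have hfun : (fun s : ℝ => G0 (Function.update x 3 s)) =
              fun s => w s / (1 - w s * x 0 * x 1 * x 2) := by
            funext s; rw [hG0]
            simp only [Function.update_self, Function.update_of_ne h03, Function.update_of_ne h13,
              Function.update_of_ne h23]
          rw [hfun, hD0]
          simp only
          have hnum : HasDerivAt w (w' (x 3)) (x 3) := hwd (x 3) hx3
          have hden : HasDerivAt (fun s : ℝ => 1 - w s * x 0 * x 1 * x 2) (-(w' (x 3) * x 0 * x 1 * x 2)) (x 3) :=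
            (((hnum.mul_const (x 0)).mul_const (x 1)).mul_const (x 2)).const_sub 1
          refine (hnum.div hden (hPne x hx)).congr_deriv ?_
          field_simp [hPne x hx]
          ring
      · -- element 1, along `u = x 2`
        simp only [Matrix.cons_val_one, Matrix.cons_val_zero]
        refine ⟨hG1sa, hD1sa, hbound hG1c, fun x hx => ?_, fun x hx _ => ?_⟩
        · show ContinuousOn (fun s : ℝ => G1 (Function.update x 2 s)) (Set.Icc (0:ℝ) 1)
          exact hG1c.comp (hcu x 2).continuousOn fun s hs => hupd x hx 2 s hs
        · show HasDerivAt (fun s : ℝ => G1 (Function.update x 2 s)) (D1 x) (x 2)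
          have hfun : (fun s : ℝ => G1 (Function.update x 2 s)) =
              fun s => -(w' (x 3) * s) / (1 - w (x 3) * x 0 * x 1 * s) := by
            funext s; rw [hG1]
            simp only [Function.update_self, Function.update_of_ne h02, Function.update_of_ne h12,
              Function.update_of_ne h32]
          rw [hfun, hD1]
          simp only
          have hnum : HasDerivAt (fun s : ℝ => -(w' (x 3) * s)) (-(w' (x 3) * 1)) (x 2) :=
            ((hasDerivAt_id' (x 2)).const_mul (w' (x 3))).neg
          have hden : HasDerivAt (fun s : ℝ => 1 - w (x 3) * x 0 * x 1 * s) (-(w (x 3) * x 0 * x 1 * 1)) (x 2) :=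
            ((hasDerivAt_id' (x 2)).const_mul (w (x 3) * x 0 * x 1)).const_sub 1
          refine (hnum.div hden (hPne x hx)).congr_deriv ?_
          field_simp [hPne x hx]
          ring
    · refine Fin.forall_fin_two.mpr ⟨?_, ?_⟩
      · simp only [Matrix.cons_val_zero]
        exact ⟨hq0d, fun x _ => by rw [hq0i, hI0]⟩
      · simp only [Matrix.cons_val_one, Matrix.cons_val_zero]
        exact ⟨hq1d, fun x _ => by rw [hq1i, hI1]⟩
  -- the pointwise identity on the cube
  refine fibStokesDecomposable_congr_off_null 4 _ _ ∅
    Literature.ModelTheory.ExponentialFields.isSemialgebraic_empty measure_empty (fun x _ _ => ?_) hdec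
  have hface0 : G0 (Function.update x 3 1) - G0 (Function.update x 3 0) =
      w 1 / (1 - w 1 * x 0 * x 1 * x 2) - w 0 / (1 - w 0 * x 0 * x 1 * x 2) := by
    rw [hG0]
    simp only [Function.update_self, Function.update_of_ne h03, Function.update_of_ne h13,
      Function.update_of_ne h23]
  have hface1 : G1 (Function.update x 2 1) - G1 (Function.update x 2 0) =
      -(w' (x 3) / (1 - w (x 3) * x 0 * x 1)) := by
    rw [hG1]
    simp only [Function.update_self, Function.update_of_ne h02, Function.update_of_ne h12,
      Function.update_of_ne h32, mul_one, mul_zero, neg_zero, zero_div, sub_zero, neg_div]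
  have hsum : D0 x + D1 x = 0 := by rw [hD0, hD1]; simp only; ring
  simp only [Fin.sum_univ_two, Matrix.cons_val_zero, Matrix.cons_val_one, hq0i, hq1i, hI0, hI1, hface0, hface1]
  linarith

end Summit.KontsevichZagierPeriods.KontsevichZagierPeriods.Cruxes.StokesGeneration.FibrewiseStokes

end
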